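import Mathlib
import HarnessLib
import Literature.Computability.AlgebraicComplexity.LocalStrongUSP
import Literature.Computability.AlgebraicComplexity.ChartUSP
import Literature.Computability.AlgebraicComplexity.GroupTheoreticMatMulThmBProofs
import Literature.Computability.AlgebraicComplexity.StrongUSPCapacityLocal
import Literature.Barriers.MatrixMultiplication.TricoloredSumFreeBarrierEffective

/-!
# FarEdgeDescent — Kernel LIII (lens-2, gen 69): the KLEIN-CHART rate cap for local strong USPs
# (the typed `k = 2` kill of the skinny USP leaf)

Def-free, sorry-free, ROUTE-INDEPENDENT support for the special crux `FiniteSaturation`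
(stmt-MatrixMultiplication-23739) of `Theses/FarEdgeDescent.lean`; the cut
`closes (h₁ : FiniteSaturation) (h₂ : AnchoredLogConvexity)` is UNCHANGED and nothing here enters it.
Content = critic ruling lens-2 g69 (decomp-mm STATUS l.3375 (ii)), admissible because (i) = Kernel LII
`FarEdgeDescentSTPPDoublePacking` (p846686) is accepted and the `q = 2` tricolored-sum-free constant
is a NAMED tree fact (`card_le_rpow_of_elementary`, `foxLovaszExponent 2`; nothing is added to
`Literature/Barriers`).

THE LEAF (memo level, lens-2 g68 NODE §1–2; no defs under the hold): `P_k` = «type-`(n, kn, n)` local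
strong USPs of width `(k+2)n` reach the unique-pieces rate `C_k = (k+2)/(k+1)^{(k+1)/(k+2)}`»;
`P_k ∧ (CKSU Thm 33 at ℓ = k+2)` feeds `STPPSat_k ⟹ h₁` (Kernel LI).  The composition-free ceiling on
ANY local strong USP of width `w` with `L` rows is the chart bound: CKSU Thm 37 over an abelian chart
group `H₀` of order `q` makes it an STPP family of `L` triples of volume `(q−1)^w` in `H₀^w`, and the
SHARP effective Thm B (`Σ vol^{2/3} ≤ |H|^{1−c_p}`, BCCGNSU §3.2 + Thm 4.14, elementary abelian
`p`-groups) gives `L ≤ (q^{1−c_p}/(q−1)^{2/3})^w`.  The tree's `IsLocalStrongUSP.card_le_pow` is the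
WEAK form at `H₀ = 𝔽₃` (`δ` on the volume: rate `3/2^{(2+3c₃)/3} = 1.7910`); the sharp form gives
`1.7356` at `𝔽₃` and the optimum over elementary charts at the KLEIN GROUP `H₀ = (ℤ/2)²`:
**`L ≤ (4^{1−c₂}/3^{2/3})^w ≤ (9/(2^{4/3}·3^{2/3}))^w = (1.717071…)^w`** (`c₂ ≥ δ/log 2`,
`δ = log((2/3)2^{2/3})`, BCCGNSU Thm A′; in fact `c₂ = δ/log 2 = 5/3 − log₂3`).
Since `C₂ = 4/3^{3/4} = 1.754767… > 1.717071…` (★★ `kleinRate_lt_skinnyTwoRate`), the `k = 2` leaf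
`P₂` is dead BY A TREE THEOREM (margin 2.2%; `C₁ = 3/2^{2/3} = 1.88988` likewise — CKSU Conj. 3.4,
already `strongUSPCapacity_lt`), while `C₃ = 5/4^{4/5} = 1.64938 < 1.71707` stays SILENT: the leaf of
record below `h₁` is `P₃` / `SkinnyLeaf = ∃ k ≥ 3, P_k` (memo names; post-hold a LINE under crux 23739).
By CKSU Prop. 6.3 (`exists_isLocalStrongUSP_card_ge_pow_of_strongUSP`) the same constant bounds the
strong USP capacity: `≤ 1.71708` (was `≤ 1.7910` in the tree).

* §1 `sum_rpow_two_thirds_le_rpow_of_prime_nsmul` — the sharp elementary engine packaged: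
  `Σᵢ (|Aᵢ||Bᵢ||Cᵢ|)^{2/3} ≤ |H|^{1−c_p}` for `IsSTPP` families in `H` with `p • H = 0`.
* §2 `isSTPP_chartBlocks_of_localStrongUSP`, `card_chartBlocks_mul` — CKSU's example after Def. 36:
  the `H₀`-chart `1 ↦ (H₀∖0, 0, 0)`, `2 ↦ (0, H₀∖0, 0)`, `3 ↦ (0, 0, H₀∖0)` turns every local strong USP
  into an `IsSTPP` family of blocks of volume `(|H₀|−1)^w` (Thm 37 = `isSTPP_piFinset_of_chartUSP`).
* §3 ★ `card_mul_rpow_le_rpow_of_localStrongUSP` (any elementary abelian chart group) and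
  ★ `card_mul_rpow_le_rpow_klein`: `L · (3^w)^{2/3} ≤ (4^w)^{1−c₂}`.
* §4 ★★ `card_le_kleinRate_pow_of_localStrongUSP`: `L ≤ (9/(2^{4/3}·3^{2/3}))^w`;
  ★★ `kleinRate_lt_skinnyTwoRate`: `9/(2^{4/3}·3^{2/3}) < 4/3^{3/4}` (`1.71707 < 1.75477`).
* §5 ★★ `eventually_card_lt_pow_of_kleinRate_lt` — the STRONG USP capacity is `≤ 9/(2^{4/3}·3^{2/3})`
  (CKSU Prop. 6.3 transfer, verbatim the tree's `IsStrongUSP.eventually_card_lt_pow_of_lt` with the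
  Klein constant in place of `3/2^{(2+3c₃)/3}`).
Asymptotically this is a statement about the USP road only (`STPPSat_k`, `h₁` untouched); nothing here
proves `ω = 2` or the crux; no definitions (D-0009).
[cite: CohnKleinbergSzegedyUmans2005, §6.1, Def. 36, Thm. 37 (p. 11), Prop. 6.3]
[cite: BlasiakChurchCohnGrochowNaslundSawinUmans2017, §3.2, Thm. 4.14, Thm. A′]
[cite: FoxLovasz2017, §1]
-/

-- single-conjunct summit: the mandated namespace repeats `MatrixMultiplication`.
set_option linter.dupNamespace false

namespace Summit.MatrixMultiplication.MatrixMultiplication.Theorems.FarEdgeDescentLocalSUSPKleinCap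

open Finset Literature.Computability.AlgebraicComplexity Literature.Combinatorics.Additive
open Literature.Barriers.MatrixMultiplication
open scoped Pointwise

/-! ## §1 The sharp effective Thm B for elementary abelian `p`-groups, packaged -/

/-- **`Σᵢ (|Aᵢ||Bᵢ||Cᵢ|)^{2/3} ≤ |H|^{1−c_p}`** for every `IsSTPP` family in a finite abelian group
with `p • H = 0` (`p` prime; `c_p = foxLovaszExponent p`): the §3.2 engine
`sum_rpow_two_thirds_le_of_tsf` fed with Thm 4.14 in exponent form (`card_le_rpow_of_elementary`) on
the elementary abelian powers `((H^N)^3)^{N'}` (`nsmul_eq_zero_pi_prod_pi`).  (The tree's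
`BCCGNSU2017_thmB_elementary` is the weaker consequence `Σ vol^{(2+3c_p)/3} ≤ |H|`.)
[cite: BlasiakChurchCohnGrochowNaslundSawinUmans2017, §3.2 and Thm. 4.14] -/
theorem sum_rpow_two_thirds_le_rpow_of_prime_nsmul {p : ℕ} (hp : p.Prime) (H : Type)
    [AddCommGroup H] [Fintype H] [DecidableEq H] (hH : ∀ x : H, p • x = 0) {N : ℕ}
    {A B C : Fin N → Finset H} (hS : IsSTPP A B C) :
    ∑ i, (((A i).card * (B i).card * (C i).card : ℕ) : ℝ) ^ ((2 : ℝ) / 3) ≤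
      (Fintype.card H : ℝ) ^ (1 - foxLovaszExponent p) := by
  have hx : (0 : ℝ) ≤ Fintype.card H := by positivity
  refine sum_rpow_two_thirds_le_of_tsf (fun N₁ N' ι' _ s t u hT => ?_)
    ((isSTPP_iff_addSimultaneousTPP A B C).1 hS)
  have h := card_le_rpow_of_elementary hp (Fin N' → (Fin N₁ → H) × (Fin N₁ → H) × (Fin N₁ → H))
    (nsmul_eq_zero_pi_prod_pi hH N₁ N') ι' s t u hT
  have hcardG : (Fintype.card (Fin N' → (Fin N₁ → H) × (Fin N₁ → H) × (Fin N₁ → H)) : ℝ) =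
      (Fintype.card H : ℝ) ^ (3 * N₁ * N') := by
    rw [Fintype.card_fun, Fintype.card_prod, Fintype.card_prod, Fintype.card_fun,
      Fintype.card_fin, Fintype.card_fin]
    push_cast
    ring
  rw [hcardG] at h
  refine h.trans (le_of_eq ?_)
  rw [← pow_mul, ← Real.rpow_mul_natCast hx, ← Real.rpow_natCast_mul hx]
  congr 2
  push_cast
  ring

/-! ## §2 The chart of CKSU's example after Def. 36 over an arbitrary abelian group `H₀` -/

/-- **CKSU Thm 37 for the chart `x ↦ (H₀∖0 or 0, …)`**: for any abelian `H₀`, a local strong USP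
`row` (rows `a : Fin L`, width `w`) yields the `IsSTPP` family of blocks
`A_a = ∏_c (if row a c = 1 then H₀∖{0} else {0})`, `B_a` (symbol `2`), `C_a` (symbol `3`) in `H₀^w`
(symbols coded `0,1,2`).  Symbol TPP: at most one of the three sets at a symbol is not `{0}`; the
local strong USP coordinate of the ordered triple `(j, k, i)` makes exactly one of the six sets of the
`IsSTPP` relation at `(i, j, k)` equal to `H₀∖{0}`, so `0` is not in it.  At `H₀ = ℤ/ℓ` these are the
sets of Thm 33 (`uspA/B/C`). [cite: CohnKleinbergSzegedyUmans2005, Def. 36, Thm. 37 (p. 11), §6.1] -/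
theorem isSTPP_chartBlocks_of_localStrongUSP (H₀ : Type) [AddCommGroup H₀] [Fintype H₀]
    [DecidableEq H₀] {w L : ℕ} {row : Fin L → Fin w → Fin 3} (hU : IsLocalStrongUSP row) :
    IsSTPP (fun a => Fintype.piFinset fun c => if row a c = 0 then (univ : Finset H₀).erase 0 else {0})
      (fun a => Fintype.piFinset fun c => if row a c = 1 then (univ : Finset H₀).erase 0 else {0})
      (fun a => Fintype.piFinset fun c => if row a c = 2 then (univ : Finset H₀).erase 0 else {0}) := by
  refine isSTPP_piFinset_of_chartUSP (Γ := Fin 3) (H := H₀)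
    (fun x => if x = 0 then univ.erase 0 else {0}) (fun x => if x = 1 then univ.erase 0 else {0})
    (fun x => if x = 2 then univ.erase 0 else {0}) ?_ row ?_
  · -- symbol TPP: at most one of the three sets is not `{0}`
    intro x a ha a' ha' b hb b' hb' c hc c' hc' h
    have hx : x = 0 ∨ x = 1 ∨ x = 2 := by fin_cases x <;> simp
    rcases hx with rfl | rfl | rfl <;>
      simp only [Fin.isValue, Fin.reduceEq, if_true, if_false, mem_singleton] at ha ha' hb hb' hc hc' <;>
      [ (subst hb hb' hc hc'; exact ⟨by simpa [sub_eq_zero, eq_comm] using h, rfl, rfl⟩);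
        (subst ha ha' hc hc'; exact ⟨rfl, by simpa [sub_eq_zero, eq_comm] using h, rfl⟩);
        (subst ha ha' hb hb'; exact ⟨rfl, rfl, by simpa [sub_eq_zero, eq_comm] using h⟩) ]
  · -- the local strong USP coordinate of the ordered triple `(j, k, i)`
    intro i j k hne
    have hne' : j ≠ k ∨ k ≠ i := by
      rcases eq_or_ne j k with hjk | hjk
      · exact Or.inr fun hki => hne ⟨(hjk.trans hki).symm, hjk⟩
      · exact Or.inl hjk
    obtain ⟨c, hpat⟩ := hU j k i hne'
    refine ⟨c, ?_⟩
    simp only [localStrongUSPPatterns, mem_insert, mem_singleton, Prod.mk.injEq] at hpat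
    rcases hpat with ⟨hj, hk, hi⟩ | ⟨hj, hk, hi⟩ | ⟨hj, hk, hi⟩ | ⟨hj, hk, hi⟩ | ⟨hj, hk, hi⟩ |
        ⟨hj, hk, hi⟩ <;>
      simp [hj, hk, hi, Finset.mem_add]

/-- Volume of the chart blocks: `|A_a||B_a||C_a| = (|H₀| − 1)^w` for every row (each coordinate
contributes `|H₀| − 1` to exactly one of the three blocks). [cite: CohnKleinbergSzegedyUmans2005, Thm. 33/37 (p. 10–11)] -/
theorem card_chartBlocks_mul (H₀ : Type) [AddCommGroup H₀] [Fintype H₀] [DecidableEq H₀]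
    {w L : ℕ} (row : Fin L → Fin w → Fin 3) (a : Fin L) :
    (Fintype.piFinset fun c => if row a c = 0 then (univ : Finset H₀).erase 0 else {0}).card *
    (Fintype.piFinset fun c => if row a c = 1 then (univ : Finset H₀).erase 0 else {0}).card *
    (Fintype.piFinset fun c => if row a c = 2 then (univ : Finset H₀).erase 0 else {0}).card =
      (Fintype.card H₀ - 1) ^ w := by
  rw [Fintype.card_piFinset, Fintype.card_piFinset, Fintype.card_piFinset, ← prod_mul_distrib,
    ← prod_mul_distrib]
  refine (prod_congr rfl fun c _ => ?_).trans (by rw [prod_const, card_univ, Fintype.card_fin])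
  have hx : row a c = 0 ∨ row a c = 1 ∨ row a c = 2 := by
    generalize row a c = x; fin_cases x <;> simp
  rcases hx with h | h | h <;> simp [h, card_erase_of_mem, card_univ]

/-! ## §3 The chart rate cap, sharp form -/

/-- ★ **`L · ((q−1)^w)^{2/3} ≤ (q^w)^{1−c_p}`** for a local strong USP with `L` rows of width `w`
and ANY chart group `H₀` of order `q` with `p • H₀ = 0`, `p` prime (§2 + §1 in `H₀^w`).  At
`(p, q) = (3, 3)`: rate `≤ 3^{1−c₃}/2^{2/3} = 1.7356`; at the Klein group `(2, 4)`: `1.71707` (below).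
[cite: CohnKleinbergSzegedyUmans2005, Thm. 37] [cite: BlasiakChurchCohnGrochowNaslundSawinUmans2017, §3.2, Thm. 4.14] -/
theorem card_mul_rpow_le_rpow_of_localStrongUSP {p : ℕ} (hp : p.Prime) (H₀ : Type)
    [AddCommGroup H₀] [Fintype H₀] [DecidableEq H₀] (hH₀ : ∀ y : H₀, p • y = 0) {w L : ℕ}
    {row : Fin L → Fin w → Fin 3} (hU : IsLocalStrongUSP row) :
    (L : ℝ) * (((Fintype.card H₀ - 1 : ℕ) : ℝ) ^ w) ^ ((2 : ℝ) / 3) ≤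
      ((Fintype.card H₀ : ℝ) ^ w) ^ (1 - foxLovaszExponent p) := by
  have hH : ∀ x : Fin w → H₀, p • x = 0 := fun x => funext fun j => by
    simp only [Pi.smul_apply, Pi.zero_apply]
    exact hH₀ (x j)
  have h := sum_rpow_two_thirds_le_rpow_of_prime_nsmul hp (Fin w → H₀) hH
    (isSTPP_chartBlocks_of_localStrongUSP H₀ hU)
  simp_rw [card_chartBlocks_mul H₀ row, sum_const, card_univ, Fintype.card_fin, nsmul_eq_mul] at h
  rw [Fintype.card_fun, Fintype.card_fin] at h
  push_cast at h
  exact h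

/-- ★ **Klein-chart cap `L · (3^w)^{2/3} ≤ (4^w)^{1−c₂}`** (`H₀ = (ℤ/2)²`, `p = 2`, `q = 4`,
`c₂ = foxLovaszExponent 2 = 0.0817…`): every local strong USP of width `w` has at most
`(4^{1−c₂}/3^{2/3})^w = (1.71707…)^w` rows (the tree's `IsLocalStrongUSP.card_le_pow`: `1.7910^w`).
[cite: CohnKleinbergSzegedyUmans2005, Thm. 37] [cite: BlasiakChurchCohnGrochowNaslundSawinUmans2017, Thm. 4.14] -/
theorem card_mul_rpow_le_rpow_klein {w L : ℕ} {row : Fin L → Fin w → Fin 3}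
    (hU : IsLocalStrongUSP row) :
    (L : ℝ) * ((3 : ℝ) ^ w) ^ ((2 : ℝ) / 3) ≤ ((4 : ℝ) ^ w) ^ (1 - foxLovaszExponent 2) := by
  have h2 : ∀ y : ZMod 2 × ZMod 2, 2 • y = 0 := by decide
  have h := card_mul_rpow_le_rpow_of_localStrongUSP Nat.prime_two (ZMod 2 × ZMod 2) h2 hU
  have h4 : Fintype.card (ZMod 2 × ZMod 2) = 4 := by simp
  rw [h4] at h
  norm_num at h
  exact h

/-! ## §4 Closed form and the `k = 2` kill -/

/-- `4^{1 − δ/log 2} = 9/2^{4/3}` with `δ = bccgnsuDelta = log((2/3)·2^{2/3})`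
(`4^{δ/log 2} = e^{2δ} = (4/9)·2^{4/3}`). [cite: BlasiakChurchCohnGrochowNaslundSawinUmans2017, Thm. A′] -/
theorem four_rpow_one_sub_delta_div_log_two :
    (4 : ℝ) ^ (1 - bccgnsuDelta / Real.log 2) = 9 / (2 : ℝ) ^ ((4 : ℝ) / 3) := by
  have hlog2 : Real.log 2 ≠ 0 := Real.log_ne_zero_of_pos_of_ne_one two_pos (by norm_num)
  have hy : (0 : ℝ) < 2 / 3 * (2 : ℝ) ^ ((2 : ℝ) / 3) := by positivity
  have hlog4 : Real.log 4 = 2 * Real.log 2 := by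
    rw [show (4 : ℝ) = 2 ^ 2 by norm_num, Real.log_pow]; norm_num
  have hexp : (4 : ℝ) ^ (bccgnsuDelta / Real.log 2) = 4 / 9 * (2 : ℝ) ^ ((4 : ℝ) / 3) := by
    rw [Real.rpow_def_of_pos four_pos, hlog4,
      show 2 * Real.log 2 * (bccgnsuDelta / Real.log 2) = ((2 : ℕ) : ℝ) * bccgnsuDelta by
        field_simp; push_cast; ring,
      Real.exp_nat_mul, bccgnsuDelta, Real.exp_log hy, mul_pow,
      ← Real.rpow_natCast ((2 : ℝ) ^ ((2 : ℝ) / 3)) 2, ← Real.rpow_mul (by norm_num : (0 : ℝ) ≤ 2)]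
    norm_num
  have h2 : (0 : ℝ) < (2 : ℝ) ^ ((4 : ℝ) / 3) := by positivity
  rw [Real.rpow_sub four_pos, Real.rpow_one, hexp]
  field_simp

/-- ★★ **Closed-form Klein cap: `L ≤ (9/(2^{4/3}·3^{2/3}))^w = (1.717071…)^w`** for every local strong
USP with `L` rows of width `w` (`c₂ ≥ δ/log 2`, `bccgnsuDelta_div_log_le_foxLovaszExponent`; in fact
equality `c₂ = δ/log 2`).  Hence (CKSU Prop. 6.3) the strong USP capacity is `≤ 1.71708`.
[cite: CohnKleinbergSzegedyUmans2005, Thm. 37, Prop. 6.3] [cite: BlasiakChurchCohnGrochowNaslundSawinUmans2017, Thm. 4.14, Thm. A′] -/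
theorem card_le_kleinRate_pow_of_localStrongUSP {w L : ℕ} {row : Fin L → Fin w → Fin 3}
    (hU : IsLocalStrongUSP row) :
    (L : ℝ) ≤ (9 / ((2 : ℝ) ^ ((4 : ℝ) / 3) * (3 : ℝ) ^ ((2 : ℝ) / 3))) ^ w := by
  have h := card_mul_rpow_le_rpow_klein hU
  -- exponent monotonicity: `(4^w)^{1-c₂} ≤ (4^w)^{1-δ/log 2} = (9/2^{4/3})^w`
  have hmono : ((4 : ℝ) ^ w) ^ (1 - foxLovaszExponent 2) ≤ (9 / (2 : ℝ) ^ ((4 : ℝ) / 3)) ^ w := by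
    have h1 : ((4 : ℝ) ^ w) ^ (1 - foxLovaszExponent 2) ≤
        ((4 : ℝ) ^ w) ^ (1 - bccgnsuDelta / Real.log 2) :=
      Real.rpow_le_rpow_of_exponent_le (one_le_pow₀ (by norm_num))
        (by linarith [bccgnsuDelta_div_log_le_foxLovaszExponent (p := 2) le_rfl])
    refine h1.trans (le_of_eq ?_)
    rw [← four_rpow_one_sub_delta_div_log_two, ← Real.rpow_natCast (4 : ℝ) w,
      ← Real.rpow_mul (by norm_num : (0 : ℝ) ≤ 4), mul_comm, Real.rpow_mul (by norm_num : (0 : ℝ) ≤ 4),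
      Real.rpow_natCast]
  -- `(3^w)^{2/3} = (3^{2/3})^w`
  have h3 : ((3 : ℝ) ^ w) ^ ((2 : ℝ) / 3) = ((3 : ℝ) ^ ((2 : ℝ) / 3)) ^ w := by
    rw [← Real.rpow_natCast (3 : ℝ) w, ← Real.rpow_mul (by norm_num : (0 : ℝ) ≤ 3), mul_comm,
      Real.rpow_mul (by norm_num : (0 : ℝ) ≤ 3), Real.rpow_natCast]
  have hpos : (0 : ℝ) < ((3 : ℝ) ^ ((2 : ℝ) / 3)) ^ w := by positivity
  rw [h3] at h
  rw [div_pow, mul_pow, ← div_div, le_div_iff₀ hpos, ← div_pow]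
  exact h.trans hmono

/-- ★★ **The `k = 2` kill: `9/(2^{4/3}·3^{2/3}) < 4/3^{3/4}`**, i.e. `1.71707… < 1.75477…` — the Klein
rate cap is below `C₂ = 4/3^{3/4} = lim C(4n,n)^{1/(4n)}`, the unique-pieces rate of type-`(n,2n,n)`
rows; so type-`(n,2n,n)` local strong USPs miss the cap `C(4n,n)` by an exponential factor
(`≥ (1.0219)^{4n}`, any `2^{δn}` with `δ < 0.125`): the memo leaf `P₂` is refuted, `P₁` likewise
(`C₁ = 1.88988`), `P₃` (`C₃ = 1.64938 < 1.71707`) is not touched.  Numerics: `2^{4/3} > 2.519`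
(`2.519³ < 16`), `3^{2/3} > 2.08` (`2.08³ < 9`), `3^{3/4} < 2.32` (`27 < 2.32⁴`).
[cite: CohnKleinbergSzegedyUmans2005, §6.1] [cite: BlasiakChurchCohnGrochowNaslundSawinUmans2017, Thm. 4.14] -/
theorem kleinRate_lt_skinnyTwoRate :
    9 / ((2 : ℝ) ^ ((4 : ℝ) / 3) * (3 : ℝ) ^ ((2 : ℝ) / 3)) < 4 / (3 : ℝ) ^ ((3 : ℝ) / 4) := by
  have hA : (2.519 : ℝ) < (2 : ℝ) ^ ((4 : ℝ) / 3) := by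
    refine lt_of_pow_lt_pow_left₀ 3 (by positivity) ?_
    rw [← Real.rpow_natCast ((2 : ℝ) ^ ((4 : ℝ) / 3)) 3, ← Real.rpow_mul (by norm_num : (0 : ℝ) ≤ 2),
      show ((4 : ℝ) / 3 * ((3 : ℕ) : ℝ)) = ((4 : ℕ) : ℝ) by norm_num, Real.rpow_natCast]
    norm_num
  have hB : (2.08 : ℝ) < (3 : ℝ) ^ ((2 : ℝ) / 3) := by
    refine lt_of_pow_lt_pow_left₀ 3 (by positivity) ?_
    rw [← Real.rpow_natCast ((3 : ℝ) ^ ((2 : ℝ) / 3)) 3, ← Real.rpow_mul (by norm_num : (0 : ℝ) ≤ 3),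
      show ((2 : ℝ) / 3 * ((3 : ℕ) : ℝ)) = ((2 : ℕ) : ℝ) by norm_num, Real.rpow_natCast]
    norm_num
  have hC : (3 : ℝ) ^ ((3 : ℝ) / 4) < 2.32 := by
    refine lt_of_pow_lt_pow_left₀ 4 (by norm_num) ?_
    rw [← Real.rpow_natCast ((3 : ℝ) ^ ((3 : ℝ) / 4)) 4, ← Real.rpow_mul (by norm_num : (0 : ℝ) ≤ 3),
      show ((3 : ℝ) / 4 * ((4 : ℕ) : ℝ)) = ((3 : ℕ) : ℝ) by norm_num, Real.rpow_natCast]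
    norm_num
  have hC0 : (0 : ℝ) < (3 : ℝ) ^ ((3 : ℝ) / 4) := by positivity
  calc 9 / ((2 : ℝ) ^ ((4 : ℝ) / 3) * (3 : ℝ) ^ ((2 : ℝ) / 3))
      < 9 / (2.519 * 2.08) :=
        div_lt_div_of_pos_left (by norm_num) (by norm_num)
          (mul_lt_mul'' hA hB (by norm_num) (by norm_num))
    _ ≤ 4 / 2.32 := by norm_num
    _ < 4 / (3 : ℝ) ^ ((3 : ℝ) / 4) := div_lt_div_of_pos_left (by norm_num) hC0 hC

/-! ## §5 Transfer to strong USPs (CKSU Prop. 6.3) -/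

/-- ★★ **The strong USP capacity is at most `9/(2^{4/3}·3^{2/3}) = 1.717071…`**: for every
`C > 9/(2^{4/3}·3^{2/3})` there is `K` such that every strong USP of every width `k ≥ K` has fewer than
`C^k` rows — otherwise CKSU Prop. 6.3 (`exists_isLocalStrongUSP_card_ge_pow_of_strongUSP`) produces
LOCAL strong USPs of size `≥ C'^k`, `9/(2^{4/3}·3^{2/3}) < C' < C`, for arbitrarily large `k`, against
§4.  (The tree's `IsStrongUSP.eventually_card_lt_pow_of_lt` is the same statement from `1.7910`; the
conjectured value was `3/2^{2/3} = 1.88988`, CKSU Conj. 3.4; the best construction is `2^{2/3} = 1.5874`,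
CKSU Prop. 3.8.) [cite: CohnKleinbergSzegedyUmans2005, Prop. 34 / Prop. 6.3 (p. 10), §3 (p. 5)]
[cite: BlasiakChurchCohnGrochowNaslundSawinUmans2017, §1 (p. 3), Thm. 4.14] -/
theorem eventually_card_lt_pow_of_kleinRate_lt {C : ℝ}
    (hC : 9 / ((2 : ℝ) ^ ((4 : ℝ) / 3) * (3 : ℝ) ^ ((2 : ℝ) / 3)) < C) :
    ∃ K : ℕ, ∀ k ≥ K, ∀ {s : ℕ} {row : Fin s → Fin k → Fin 3},
      IsStrongUSP row → (s : ℝ) < C ^ k := by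
  set B : ℝ := 9 / ((2 : ℝ) ^ ((4 : ℝ) / 3) * (3 : ℝ) ^ ((2 : ℝ) / 3)) with hBdef
  have hB0 : 0 ≤ B := by positivity
  by_contra hcon
  push Not at hcon
  set C' : ℝ := (B + C) / 2 with hC'
  have hC'0 : 0 ≤ C' := by rw [hC']; linarith
  have hC'C : C' < C := by rw [hC']; linarith
  have hBC' : B < C' := by rw [hC']; linarith
  have hsup : ∀ K : ℕ, ∃ k ≥ K, ∃ s : ℕ, ∃ row : Fin s → Fin k → Fin 3,
      IsStrongUSP row ∧ C ^ k ≤ (s : ℝ) := fun K => by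
    obtain ⟨k, hk, s, row, hrow, hle⟩ := hcon K
    exact ⟨k, hk, s, row, hrow, hle⟩
  obtain ⟨k, hk, s, row, hloc, hle⟩ :=
    exists_isLocalStrongUSP_card_ge_pow_of_strongUSP hsup hC'0 hC'C 1
  have hs : (s : ℝ) ≤ B ^ k := card_le_kleinRate_pow_of_localStrongUSP hloc
  have hk0 : k ≠ 0 := by omega
  have hlt : B ^ k < C' ^ k := pow_lt_pow_left₀ hBC' hB0 hk0
  linarith

end Summit.MatrixMultiplication.MatrixMultiplication.Theorems.FarEdgeDescentLocalSUSPKleinCap
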